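import Mathlib.Topology.MetricSpace.Closeds
import Mathlib.Probability.ConditionalProbability
import Literature.Probability.RandomPlanarGeometry.Curve
import Literature.Probability.RandomPlanarGeometry.CurveSpace
import Literature.Probability.RandomPlanarGeometry.LoopEnsembleSpace
import Literature.Probability.RandomPlanarGeometry.ConformalMap
import Literature.Probability.RandomPlanarGeometry.PlanarDomains
import HarnessLib

-- provenance: harness21/H21/H21/Prelude/Stoch/CLE.lean @ 7fbbdec (interim HEAD d8f2665); M5 mechanical rewrite
/-!
# Conformal loop ensembles (hypothesis structure)

Trunk `Stoch`, prelude item `CLE` (notion `cle_loop_ensemble`).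

A *conformal loop ensemble* `CLE_κ` in a simply connected planar domain `D` is a random
countable collection of loops in `D̄` which is conformally invariant and satisfies a domain
Markov (restriction) property; for `κ ∈ (8/3, 4]` the loops are simple, disjoint and do not
touch the boundary, and Sheffield–Werner proved that these axioms characterise the one-parameter
family `CLE_κ`, `κ ∈ (8/3, 4]`.

We do **not** construct CLE. Instead `Literature.IsCLEFamily κ μ` is a *hypothesis structure*
(a `Prop`-valued structure) on a family `μ : JordanDomain → Measure (LoopSpace ℂ)` of laws of
random loop collections indexed by Jordan domains, recording the Sheffield–Werner axioms in the
form the statement files consume. The parameter `κ` enters only through the field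
`simple_of_le_four`; existence (`exists_isCLEFamily`, Sheffield 2009) is a sorried theorem.

Warning (tier L honesty). `IsCLEFamily 6 μ` does *not* characterise `CLE₆`: the
Sheffield–Werner characterisation is for `κ ∈ (8/3, 4]` only, and for `κ > 4` the field
`simple_of_le_four` is void. Consequently the statement `crit-perc.S05` phrased with
`IsCLEFamily 6` is weaker than the Camia–Newman theorem (CMP 268 (2006)), which identifies the
full scaling limit of critical percolation with the specific process `CLE₆` built from `SLE₆`.

No uniqueness theorem. The outline asked for a sorried
`IsCLEFamily.unique_of_le_four : IsCLEFamily κ μ → IsCLEFamily κ μ' → 8/3 < κ ∧ κ ≤ 4 → μ = μ'`.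
This is *false* for a `κ`-indexed hypothesis structure: `κ` is not an axiom but only gates the
simple-loop field, so `IsCLEFamily κ μ ↔ IsCLEFamily κ' μ` whenever `κ, κ' ≤ 4` (this is the
provable lemma `IsCLEFamily.iff_of_le_four`), and genuine `CLE₃`, `CLE₄` both satisfy
`IsCLEFamily 3`. The Sheffield–Werner theorem (Ann. of Math. 176 (2012), Thms 1.1–1.3) is a
*classification* ("a Markovian simple loop ensemble is `CLE_κ` for some `κ ∈ (8/3, 4]`"), and
even that form would be false with the v0 `restriction` below; so v0 states no uniqueness
(review r00608B, finding 1).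

## Contents

* `LoopSpace.IsNonCrossing`, `LoopSpace.IsLocallyFinite`, `LoopSpace.InDomain` : sample-path
  properties of loop collections.
* `Curve.IsSimpleLoop`, `CurveClass.simpleLoop` : simple closed curves (injective on `[0, 1)`).
* `LoopSpace.avoidsFrontier` : the event "no non-trivial loop meets `∂D'`" used in the v0
  restriction axiom.
* `IsCLEFamily κ μ` : the hypothesis structure; `IsCLEFamily.iff_of_le_four`.
* `exists_isCLEFamily` : sorried existence theorem (Sheffield 2009).

Sources: S. Sheffield, *Exploration trees and conformal loop ensembles*, Duke Math. J. 147
(2009), 79–129, §1–2; S. Sheffield, W. Werner, *Conformal loop ensembles: the Markovian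
characterization and the loop-soup construction*, Ann. of Math. 176 (2012), 1827–1917, §1–2
(Theorems 1.1–1.4); F. Camia, C. M. Newman, *Two-dimensional critical percolation: the full
scaling limit*, Comm. Math. Phys. 268 (2006), 1–38, §2–3.

## Design / Mathlib

* Mathlib has no conformal loop ensembles, SLE or loop soups (grep for `CLE`, `loop ensemble`,
  `Schramm` finds nothing); it supplies `TopologicalSpace.Closeds`, `MeasureTheory.Measure.map`,
  `ProbabilityTheory.cond` (`μ[|s]`), `Metric.diam`, which we use.
* Simple loops. `CurveClass.simple` of `CurveSpace` consists of classes of *injective*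
  curves `[0, 1] → E`; a non-trivial loop (`γ 0 = γ 1`) is never injective, so the outline's
  `⊆ CurveClass.simple ∪ {c | c.IsTrivial}` would force all loops to be trivial. We therefore
  introduce `Curve.IsSimpleLoop` (a loop injective on `Set.Iio (1 : unitInterval) = [0, 1)`) and
  `CurveClass.simpleLoop`,
  and state `simple_of_le_four` with it.
* Non-crossing is the standard Camia–Newman / Aizenman–Burchard notion: for two distinct
  non-trivial loops `c, c'`, the trace of `c` lies in the closure of a single connected
  component of the complement of the trace of `c'` (Mathlib's `connectedComponentIn`), and
  symmetrically. This forbids transversal crossings but allows touching, as needed for `κ > 4`.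
  (The outline's proxy "weakly on opposite sides of some open set" is vacuous for loops with
  empty interior, review r00608B finding 2, and is not used.) Trivial (constant) loops are
  exempted: the closed collection contains every constant loop of `D̄`. Remaining v0 edge case:
  a pair with `c.range ⊆ c'.range` (e.g. a loop and a sub-arc traversed back and forth) fails
  the condition although it does not cross; such pairs have probability zero in every ensemble
  of interest.
* Non-degeneracy. The field `nontrivial` (a.s. infinitely many non-trivial loops; Sheffield
  2009 §1.1, Sheffield–Werner 2012 §2.1) excludes the degenerate families `D ↦ dirac ⊥` and
  `D ↦ dirac {constant loops of D̄}`, which satisfy all other fields for every `κ`.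
* Conformal invariance is stated for a conformal equivalence `φ : D → D'` together with a
  continuous extension `Φ : C(ℂ, ℂ)` agreeing with `φ` on `D` and mapping `D̄` into `D̄'`
  (Carathéodory's theorem provides one for Jordan domains; we take it as data), via
  `LoopSpace.map Φ` and `Measure.map`. Since `μ D'` is a probability measure, the identity
  `μ D' = (μ D).map (LoopSpace.map Φ)` implicitly asserts a.e.-measurability of
  `LoopSpace.map Φ` (otherwise `Measure.map` is `0`), which holds for the Borel map in question.
* Restriction (domain Markov property), v0 simplification. The genuine axiom conditions on
  the loops meeting `D \ D'` and asserts that in each component of the random remaining domain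
  the loops form an independent CLE. Here we only state: for a Jordan subdomain `D' ⊆ D`,
  conditionally on the event `avoidsFrontier D'` that no non-trivial loop meets `∂D'` (when this
  event has positive probability), the window restriction `LoopSpace.restrict (closure D')` of
  the sample has law `μ D'`. For actual `CLE_κ` this event is typically null for a fixed
  deterministic `D'`, so the field is close to vacuous; it is a documented placeholder for the
  Markov property and is not used by any v0 statement file. As for conformal invariance, the
  identity implicitly asserts a.e.-measurability of `LoopSpace.restrict (closure D')` w.r.t. the
  conditional law (`restrict` is Borel but not continuous on `Closeds`; otherwise `map = 0`).
  Consequently `exists_isCLEFamily` is much weaker than Sheffield's construction.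
-/

open Set Filter Topology MeasureTheory ProbabilityTheory
open scoped ENNReal NNReal

namespace Literature.Probability.RandomPlanarGeometry

variable {E : Type*}

namespace Curve

/-- A parametrised curve is a *simple loop* if it is closed (`γ 0 = γ 1`) and injective on
`[0, 1)`, i.e. it parametrises a Jordan curve (Sheffield–Werner, Ann. of Math. 176 (2012), §2.1:
CLE loops for `κ ≤ 4` are simple loops). [folklore] -/
def IsSimpleLoop [TopologicalSpace E] (γ : Curve E) : Prop :=
  γ.IsLoop ∧ InjOn γ (Iio 1)

/-- A simple loop is a loop (Sheffield–Werner 2012, §2.1). [cite: SheffieldWerner2012, §2.1] -/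
lemma IsSimpleLoop.isLoop [TopologicalSpace E] {γ : Curve E} (h : γ.IsSimpleLoop) : γ.IsLoop :=
  h.1

end Curve

namespace CurveClass

variable [MetricSpace E]

/-- The set of *simple loops* in curve space: classes of closed curves injective on `[0, 1)`.
Membership means that *some* representative is injective on `[0, 1)` (a class also contains
stalling reparametrisations, cf. `CurveClass.simple`)
(Sheffield–Werner, Ann. of Math. 176 (2012), §2.1). [folklore] -/
noncomputable def simpleLoop : Set (CurveClass E) := mk '' {γ : Curve E | γ.IsSimpleLoop}

/-- The class of a simple loop is a simple loop (Sheffield–Werner 2012, §2.1). [cite: SheffieldWerner2012, §2.1] -/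
lemma mk_mem_simpleLoop {γ : Curve E} (h : γ.IsSimpleLoop) : mk γ ∈ (simpleLoop : Set _) :=
  ⟨γ, h, rfl⟩

/-- Simple loops are loops (Sheffield–Werner 2012, §2.1). [cite: SheffieldWerner2012, §2.1] -/
lemma isLoop_of_mem_simpleLoop {c : CurveClass E} (h : c ∈ (simpleLoop : Set _)) : c.IsLoop := by
  obtain ⟨γ, hγ, rfl⟩ := h
  exact isLoop_mk.2 hγ.1

end CurveClass

namespace LoopSpace

variable [MetricSpace E]

/-- A loop collection is *non-crossing*: for any two distinct non-trivial members `c, c'`, the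
trace of `c` lies in the closure of a single connected component of the complement of the trace
of `c'` (namely `connectedComponentIn (c'.range)ᶜ z` for some `z ∉ c'.range`), and
symmetrically. Touching loops (as in `CLE_κ`, `κ > 4`) are allowed, transversal crossings are
not (Camia–Newman, CMP 268 (2006), §2, non-crossing loop configurations; Aizenman–Burchard, Duke
Math. J. 99 (1999); Sheffield, Duke Math. J. 147 (2009), §1.1). V0 edge case: a pair with
`c.range ⊆ c'.range` fails the condition, see the module docstring. [folklore] -/
def IsNonCrossing (L : LoopSpace E) : Prop :=
  ∀ c ∈ L, ∀ c' ∈ L, c ≠ c' → ¬ c.IsTrivial → ¬ c'.IsTrivial →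
    (∃ z ∉ c'.range, c.range ⊆ closure (connectedComponentIn (c'.range)ᶜ z)) ∧
      (∃ z ∉ c.range, c'.range ⊆ closure (connectedComponentIn (c.range)ᶜ z))

/-- A loop collection is *locally finite* if for every `ε > 0` only finitely many members have
diameter larger than `ε` (Sheffield, Duke Math. J. 147 (2009), §1.1; Camia–Newman, CMP 268
(2006), §2: a.s. finitely many loops of diameter `> ε` in a bounded region). This is unrelated
to Mathlib's `LocallyFinite` (a locally finite family of subsets of a topological space). [folklore] -/
def IsLocallyFinite (L : LoopSpace E) : Prop :=
  ∀ ε : ℝ, 0 < ε → {c ∈ (L : Set (CurveClass E)) | ε < Metric.diam c.range}.Finite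

/-- A loop collection *lies in* the Jordan domain `D` if every member's trace is contained in
the closed domain `closure D` (Sheffield, Duke Math. J. 147 (2009), §1.1). [folklore] -/
def InDomain (D : JordanDomain) (L : LoopSpace ℂ) : Prop :=
  ∀ c ∈ L, CurveClass.range c ⊆ closure D.carrier

/-- The event that no non-trivial loop of the collection meets the frontier of the Jordan
domain `D'`; used to state the (v0) restriction axiom of `IsCLEFamily`
(Sheffield–Werner, Ann. of Math. 176 (2012), §2.1, restriction property). [folklore] -/
def avoidsFrontier (D' : JordanDomain) : Set (LoopSpace ℂ) :=
  {L | ∀ c ∈ L, ¬ c.IsTrivial → Disjoint (CurveClass.range c) (frontier D'.carrier)}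

/-- A finite collection is locally finite (Camia–Newman, CMP 268 (2006), §2). [folklore] -/
lemma isLocallyFinite_ofFinset (s : Finset (CurveClass E)) : (ofFinset s).IsLocallyFinite :=
  fun _ _ ↦ s.finite_toSet.subset fun _ hc ↦ mem_ofFinset.1 hc.1

end LoopSpace

/-- Conformal loop ensemble axioms (hypothesis structure). A family
`μ : JordanDomain → Measure (LoopSpace ℂ)` of laws of random loop collections *is a `CLE_κ`
family* if each `μ D` is a probability measure carried by locally finite, non-crossing loop
collections in `D̄` with infinitely many non-trivial loops, consisting of simple loops when
`κ ≤ 4`, and the family is conformally invariant and satisfies the (v0, simplified) restriction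
property. These are the axioms of Sheffield–Werner, *Conformal loop ensembles: the Markovian
characterization and the loop-soup construction*, Ann. of Math. 176 (2012), §2.1, and Sheffield,
Duke Math. J. 147 (2009), §1.1.

Warning. This does *not* single out `CLE_κ` for any `κ` (in particular not `CLE₆`, cf.
Camia–Newman, CMP 268 (2006)): `κ` only gates `simple_of_le_four` (see
`IsCLEFamily.iff_of_le_four`), and the Sheffield–Werner classification for `κ ∈ (8/3, 4]` is not
stated in v0. See the module docstring for the simplifications in `conformal_invariance` and
`restriction`. [folklore] -/
structure IsCLEFamily (κ : ℝ≥0) (μ : JordanDomain → Measure (LoopSpace ℂ)) : Prop where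
  /-- Each law is a probability measure. -/
  isProbabilityMeasure : ∀ D, IsProbabilityMeasure (μ D)
  /-- Almost surely every loop of the sample lies in `D̄` (Sheffield 2009, §1.1). -/
  ae_inDomain : ∀ D, ∀ᵐ L ∂(μ D), LoopSpace.InDomain D L
  /-- Almost surely the sample is a collection of loops with countably many non-trivial members
  (Sheffield 2009, §1.1). -/
  ae_isLoopCollection : ∀ D, ∀ᵐ L ∂(μ D), LoopSpace.IsLoopCollection L
  /-- Almost surely only finitely many loops have diameter `> ε`, for every `ε > 0`
  (Sheffield 2009, §1.1). -/
  ae_isLocallyFinite : ∀ D, ∀ᵐ L ∂(μ D), LoopSpace.IsLocallyFinite L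
  /-- Almost surely no two loops cross (Sheffield 2009, §1.1; Camia–Newman 2006, §2). -/
  ae_isNonCrossing : ∀ D, ∀ᵐ L ∂(μ D), LoopSpace.IsNonCrossing L
  /-- Non-degeneracy: almost surely there are infinitely many non-trivial loops (Sheffield 2009,
  §1.1; Sheffield–Werner 2012, §2.1: the loop ensemble is a.s. a countably infinite
  collection). -/
  nontrivial : ∀ D, ∀ᵐ L ∂(μ D),
    {c ∈ ((L : LoopSpace ℂ) : Set (CurveClass ℂ)) | ¬ c.IsTrivial}.Infinite
  /-- For `κ ≤ 4` almost surely every loop is simple or trivial (Sheffield–Werner 2012, §2.1;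
  Sheffield 2009, §1.1: `CLE_κ` loops are simple iff `κ ≤ 4`). -/
  simple_of_le_four : κ ≤ 4 → ∀ D, ∀ᵐ L ∂(μ D),
    ((L : LoopSpace ℂ) : Set (CurveClass ℂ)) ⊆ CurveClass.simpleLoop ∪ {c | c.IsTrivial}
  /-- Conformal invariance: if `φ : D → D'` is a conformal equivalence with a continuous
  extension `Φ` mapping `D̄` into `D̄'`, the push-forward of `μ D` along `LoopSpace.map Φ` is
  `μ D'` (Sheffield–Werner 2012, §2.1 (conformal invariance); Camia–Newman 2006, Thm 2). -/
  conformal_invariance : ∀ (D D' : JordanDomain) (φ : ConformalEquiv D.carrier D'.carrier)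
    (Φ : C(ℂ, ℂ)), EqOn Φ φ D.carrier → MapsTo Φ (closure D.carrier) (closure D'.carrier) →
      μ D' = (μ D).map (LoopSpace.map Φ)
  /-- Restriction (domain Markov property, v0 simplification): for a Jordan subdomain
  `D' ⊆ D`, conditionally on no non-trivial loop meeting `∂D'` (an event assumed of positive
  probability), the loops inside `D̄'` have law `μ D'` (Sheffield–Werner 2012, §2.1
  (restriction); see the module docstring for what is simplified, including the implicit
  a.e.-measurability of `LoopSpace.restrict`). -/
  restriction : ∀ (D D' : JordanDomain), D'.carrier ⊆ D.carrier →
    μ D (LoopSpace.avoidsFrontier D') ≠ 0 →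
      ((μ D)[|LoopSpace.avoidsFrontier D']).map (LoopSpace.restrict (closure D'.carrier)) = μ D'

namespace IsCLEFamily

variable {κ κ' : ℝ≥0} {μ : JordanDomain → Measure (LoopSpace ℂ)}

/-- The laws of a CLE family have total mass one (Sheffield 2009, §1.1). [cite: Sheffield2009, §1.1] -/
lemma measure_univ (h : IsCLEFamily κ μ) (D : JordanDomain) : μ D univ = 1 :=
  (h.isProbabilityMeasure D).measure_univ

/-- The laws of a CLE family are non-zero (Sheffield 2009, §1.1). [cite: Sheffield2009, §1.1] -/
lemma ne_zero (h : IsCLEFamily κ μ) (D : JordanDomain) : μ D ≠ 0 :=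
  (h.isProbabilityMeasure D).ne_zero

/-- Monotonicity in the parameter: the axioms for `κ` imply those for any `κ' ≥ κ`, since `κ`
only gates the simple-loop field (design remark; Sheffield–Werner 2012, §2.1). [cite: SheffieldWerner2012, §2.1] -/
lemma mono (h : IsCLEFamily κ μ) (hκ : κ ≤ κ') : IsCLEFamily κ' μ where
  isProbabilityMeasure := h.isProbabilityMeasure
  ae_inDomain := h.ae_inDomain
  ae_isLoopCollection := h.ae_isLoopCollection
  ae_isLocallyFinite := h.ae_isLocallyFinite
  ae_isNonCrossing := h.ae_isNonCrossing
  nontrivial := h.nontrivial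
  simple_of_le_four hκ' := h.simple_of_le_four (hκ.trans hκ')
  conformal_invariance := h.conformal_invariance
  restriction := h.restriction

/-- Honest bookkeeping of the parameter: for `κ, κ' ≤ 4` the v0 axioms `IsCLEFamily κ` and
`IsCLEFamily κ'` coincide, because `κ` only gates `simple_of_le_four`. In particular no
uniqueness-at-fixed-`κ` statement can hold for `IsCLEFamily`; the Sheffield–Werner theorem
(Ann. of Math. 176 (2012), Thms 1.1–1.3) is a classification of Markovian simple loop
ensembles by `κ ∈ (8/3, 4]`, not stated in v0 (see the module docstring). [folklore] -/
lemma iff_of_le_four (hκ : κ ≤ 4) (hκ' : κ' ≤ 4) : IsCLEFamily κ μ ↔ IsCLEFamily κ' μ := by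
  constructor <;> refine fun h ↦ ⟨h.isProbabilityMeasure, h.ae_inDomain, h.ae_isLoopCollection,
    h.ae_isLocallyFinite, h.ae_isNonCrossing, h.nontrivial, fun _ ↦ h.simple_of_le_four ?_,
    h.conformal_invariance, h.restriction⟩ <;> assumption

end IsCLEFamily

/-- Existence of CLE (Sheffield, *Exploration trees and conformal loop ensembles*, Duke
Math. J. 147 (2009), Thm 1.1 / §5; simple-loop regime also Sheffield–Werner, Ann. of Math. 176
(2012), Thm 1.4 via Brownian loop soups): for every `κ ∈ (8/3, 8)` there is a family of laws
satisfying the CLE axioms. With the v0 `restriction` field this is much weaker than the cited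
constructions (see the module docstring); the `nontrivial` field rules out the degenerate
witnesses `D ↦ dirac ⊥`. Named fact (D-0014), `κ` bound inside. [cite: Sheffield2009, Thm 1.1 / §5] -/
def exists_isCLEFamily : Prop :=
  ∀ {κ : ℝ≥0}, 8 / 3 < κ ∧ κ < 8 → ∃ μ : JordanDomain → Measure (LoopSpace ℂ), IsCLEFamily κ μ

end Literature.Probability.RandomPlanarGeometry
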